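import Mathlib
import Summits.ResolutionOfSingularities.ResolutionOfSingularities.Theorems.WildQuotientsWildQuotientResolutionTwistEngineInv
import Summits.ResolutionOfSingularities.ResolutionOfSingularities.Theorems.WildQuotientsWildQuotientResolutionJordanFiveChartW1Defs
import Summits.ResolutionOfSingularities.ResolutionOfSingularities.Theorems.WildQuotientsWildQuotientResolutionJordanFiveCubicCone
import Summits.ResolutionOfSingularities.ResolutionOfSingularities.Theorems.WildQuotientsWildQuotientResolutionJordanFiveWeightLB
import Summits.ResolutionOfSingularities.ResolutionOfSingularities.Theorems.WildQuotientsWildQuotientResolutionJordanFiveTwistedChartInjective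

/-!
# RUNG V5 (J₅) — the T2-ANALOGUE `eE`: the chart ring of `W₁ = D₊(H′²t·T′²H′t²)` IS the localised cubic cone `k[S][1/Q]` through the universal twisted chart

(crux stmt-ResolutionOfSingularities-15640 `WildQuotients.WildQuotientResolution`, line `Sketch`;
chain w45c RUNG V5 HP₁ (res-L1-w45c-plan-1 NAMED 2026-08-27T11:35:13Z: stub-1 = the T2-analogue
`eE`; res-L1-w45c-stub-2 = the ring brick `exists_ringBrick_X1_model` CONSUMING `eE`). Instance of
this seat's inverse-`θ` twist engine `exists_ringEquiv_of_twistData_inv` (p530736) at the data of record: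
`I = I₁₂` (res-L1-w45c-lead-1's `gens12`, p523816), `T = H′²` / `H₃ = T′²H′` (`…JordanFiveChartW1Defs`,
p526168), `ψ = JordanFive.twistedChart` (p521874; injective p524072; values p522729; `I₁₂ ↦ (l¹²)`
p527427; `U₈` p529873), `S` = stub-2's `ThirdCone` vertex monomials of `JordanFive.cubicWeight` ∪ the
weight-`0` variables (p531897), dictionary memberships by weights (`…JordanFiveWeightLB`). Design
`L/res-L1-w45c-idea-2/RT-J5.md` §4. [OURS · L1 W4.5c] — NOT a statement of any manuscript (Hironaka
2017 is consumed nowhere); replaces the role of no printed item. Prover res-L1-w45c-stub-1. AI-written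
Lean, kernel-checked; weaker than expert review.)

**`JordanFive.exists_chartW₁_away_ringEquiv`**: for ANY localisation `C` of the Rees chart ring
`B₁ = (k[x][I₁₂t])_{(H′²t)}` at `θ₁ = (T′²H′t²)/(H′²t)²` — e.g. `Γ(chartW₁)` through res-L1-w45c-stub-5's
seam `exists_sectionsEquiv_chartW₁` (p527645) — there is `eE : C ≃+* E₁`,
`E₁ = k[S][Q⁻¹] ⊆ k[x][1/Q]` (`Q = 1 − 3lA + A²η₁`, `S` = the 12 cubic monomials
`l³,l²ξ,lξ²,ξ³,lA,lη₁,ξA,ξη₁,A³,A²η₁,Aη₁²,η₁³` ∪ `{η₂}` ∪ passengers, `k[S] = ThirdCone.cone (cubicWeight)`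
by `adjoin_vertexGen_eq_cone`), with `base F ↦ ψ₅ F`, `(g_jt)/(H′²t) ↦ q_j Q⁻²`, `θ₁ ↦ Q⁻¹`.
INVERSE DICTIONARY (RT-J5 §4, kit j275294/j277343; `t·(l¹²Q²)^μ·Q^e = ψ₅(F)·Q^{e′}`, `F ∈ I₁₂^μ`):
`l³ ← T′H′`, `l²ξ ← MT′`, `lξ² ← M²T′H′`, `ξ³ ← M³T′`, `lA ← x_aT′`, `lη₁ ← Δ₇H′`, `ξA ← x_aMT′H′`,
`ξη₁ ← MΔ₇`, `A³ ← x_a³`, `A²η₁ ← x_a²Δ₇T′`, `Aη₁² ← x_aΔ₇²H′`, `η₁³ ← Δ₇³T′H′`, `η₂ ← U₈/24`,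
passengers `x_i ← x_i`.
-/

-- single-problem summit: the doubled namespace component `ResolutionOfSingularities` is forced
set_option linter.dupNamespace false

noncomputable section

open MvPolynomial Literature.AlgebraicGeometry.Resolution

namespace Summit.ResolutionOfSingularities.ResolutionOfSingularities.Theorems.WildQuotientResolution.JordanFive

section Model

variable (k : Type) [Field k] (n : ℕ) (a b c d e : Fin n)
  (hab : a ≠ b) (hac : a ≠ c) (had : a ≠ d) (hae : a ≠ e) (hbc : b ≠ c) (hbd : b ≠ d) (hbe : b ≠ e)
  (hcd : c ≠ d) (hce : c ≠ e) (hde : d ≠ e)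

local notation3 "Qp" => (1 - 3 * X b * X a + X a ^ 2 * X d : MvPolynomial (Fin n) k)
local notation3 "LQ" => Localization.Away Qp
local notation3 "B₁" => HomogeneousLocalization.Away (reesGrading (I12 k n a b c d))
  (reesT (JordanFour.hPrime k n a b c ^ 2) (hPrime_sq_mem_I12 k n a b c d))
local notation3 "φ₁" => reesChartBase (I := I12 k n a b c d) (JordanFour.hPrime k n a b c ^ 2)
  (hPrime_sq_mem_I12 k n a b c d)
local notation3 (prettyPrint := false) "θ₁" =>
  HomogeneousLocalization.Away.mk (reesGrading (I12 k n a b c d))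
    (reesT_mem (JordanFour.hPrime k n a b c ^ 2) (hPrime_sq_mem_I12 k n a b c d)) 2
    (tSqHT2 k n a b c d) (tSqHT2_mem k n a b c d)
/-- The target generator set `S`: stub-2's vertex monomials of the cubic weight ∪ the weight-`0`
variables (as a local abbreviation, not a new object). -/
local notation3 "Sset" => (Set.range (fun v : ThirdCone.VIdx n (cubicWeight n a b c d) =>
    ((ThirdCone.vertexGen k n (cubicWeight n a b c d) v : ThirdCone.cone k n (cubicWeight n a b c d)) :
      MvPolynomial (Fin n) k)) ∪
  (fun i : Fin n => (X i : MvPolynomial (Fin n) k)) '' {i | cubicWeight n a b c d i = 0})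
local notation3 "E₁" => Algebra.adjoin k ((algebraMap (MvPolynomial (Fin n) k) LQ) '' Sset ∪
    {(IsLocalization.Away.invSelf Qp : LQ)})

/-- `Q = twistedQ` is the engine's literal `1 − 3·x_b·x_a + x_a²·x_d`. [folklore] -/
theorem twistedQ_eq_literal : JordanFour.twistedQ k n a b d = Qp := by
  simp only [JordanFour.twistedQ]; ring

/-- A triple monomial: `monomial (single i 1 + single j 1 + single l 1) 1 = X i * X j * X l`. [folklore] -/
theorem monomial_triple (i j l : Fin n) :
    (monomial (Finsupp.single i 1 + Finsupp.single j 1 + Finsupp.single l 1) (1 : k) :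
      MvPolynomial (Fin n) k) = X i * X j * X l := by
  simp only [MvPolynomial.X, monomial_mul, mul_one]

/-- A pair monomial: `monomial (single i 1 + single j 1) 1 = X i * X j`. [folklore] -/
theorem monomial_pair (i j : Fin n) :
    (monomial (Finsupp.single i 1 + Finsupp.single j 1) (1 : k) : MvPolynomial (Fin n) k) = X i * X j := by
  simp only [MvPolynomial.X, monomial_mul, mul_one]

include hab hac had hae hbc hbd hbe hcd hce hde in
-- twenty-two dictionary leaves, each a short `ring` identity
set_option maxHeartbeats 800000 in
/-- **The inverse dictionary** of the universal twisted chart: every generator `t ∈ S` satisfies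
`ψ₅(F)·Q^{e′} = t·(l¹²Q²)^μ·Q^e` for some `F ∈ I₁₂^μ`. [OURS · L1 W4.5c] -/
theorem twistedChart_dictionary (h2 : (2 : k) ≠ 0) (h3 : (3 : k) ≠ 0) :
    ∀ t ∈ Sset, ∃ (μ e₀ e' : ℕ) (F : MvPolynomial (Fin n) k), F ∈ I12 k n a b c d ^ μ ∧
      twistedChart k n a b c d e F * Qp ^ e' = t * (X b ^ 12 * Qp ^ 2) ^ μ * Qp ^ e₀ := by
  -- the chart values
  have vA := twistedChart_X_a k n a b c d e
  have vH := twistedChart_hPrime k n a b c d e hab hac hbc h2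
  have vT := twistedChart_tPrime k n a b c d e hab hac had hbc hbd hcd h2 h3
  have vM := twistedChart_mSlice k n a b c d e hab hac had hbc hbd hcd h2 h3
  have vD := twistedChart_delta7 k n a b c d e hab hac had hbc hbd hcd h2 h3
  have vU := twistedChart_uEight k n a b c d e hab hac had hae hbc hbd hbe hcd hce hde h2 h3
  have hQ := twistedQ_eq_literal k n a b d
  -- the memberships
  have mTH := tPrime_mul_hPrime_mem k n a b c d hab hac had hbc hbd hcd
  have mMT := mSlice_mul_tPrime_mem k n a b c d hab hac had hbc hbd hcd
  have mM2TH := mSlice_sq_mul_tPrime_mul_hPrime_mem k n a b c d hab hac had hbc hbd hcd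
  have mM3T := mSlice_cube_mul_tPrime_mem k n a b c d hab hac had hbc hbd hcd
  have mAT := X_a_mul_tPrime_mem k n a b c d hab hac had hbc hbd hcd
  have mAMTH := X_a_mul_mSlice_mul_tPrime_mul_hPrime_mem k n a b c d hab hac had hbc hbd hcd
  have mDH := delta7_mul_hPrime_mem k n a b c d hab hac had hbc hbd hcd
  have mMD := mSlice_mul_delta7_mem k n a b c d hab hac had hbc hbd hcd
  have mA3 := X_a_cube_mem k n a b c d
  have mA2DT := X_a_sq_mul_delta7_mul_tPrime_mem k n a b c d hab hac had hbc hbd hcd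
  have mAD2H := X_a_mul_delta7_sq_mul_hPrime_mem k n a b c d hab hac had hbc hbd hcd
  have mD3TH := delta7_cube_mul_tPrime_mul_hPrime_mem k n a b c d hab hac had hbc hbd hcd
  have mU := C_mul_uEight_mem k n a b c d e hab hac had hae hbc hbd hbe hcd hce hde (24⁻¹ : k)
  have h24 := twentyFour_mul_C_inv k n h2 h3
  rintro t (⟨v, rfl⟩ | ⟨i, hi, rfl⟩)
  · -- vertex monomials
    dsimp only
    rcases v with ⟨⟨i, hi⟩, ⟨j, hj⟩, ⟨l, hl⟩⟩ | ⟨⟨i, hi⟩, ⟨j, hj⟩, ⟨l, hl⟩⟩ | ⟨⟨i, hi⟩, ⟨j, hj⟩⟩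
    · -- weight-1 triples: `i, j, l ∈ {b, c}`
      rw [ThirdCone.coe_vertexGen, ThirdCone.vertexExp, monomial_triple, ← hQ]
      rcases (cubicWeight_eq_one_iff n a b c d hab hac hbc i).mp hi with hi' | hi' <;>
        rcases (cubicWeight_eq_one_iff n a b c d hab hac hbc j).mp hj with hj' | hj' <;>
          rcases (cubicWeight_eq_one_iff n a b c d hab hac hbc l).mp hl with hl' | hl' <;>
            (obtain rfl := hi'.symm; obtain rfl := hj'.symm; obtain rfl := hl'.symm; dsimp only)
      -- (b,b,b): l³ ← T′H′
      · refine ⟨1, 0, 0, _, by simpa using mTH, ?_⟩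
        simp only [map_mul, vT, vH]; ring
      -- (b,b,c), (b,c,b), (c,b,b): l²ξ ← MT′;  (b,c,c), (c,b,c), (c,c,b): lξ² ← M²T′H′
      · refine ⟨1, 0, 0, _, by simpa using mMT, ?_⟩
        simp only [map_mul, vM, vT]; ring
      · refine ⟨1, 0, 0, _, by simpa using mMT, ?_⟩
        simp only [map_mul, vM, vT]; ring
      · refine ⟨2, 0, 0, _, mM2TH, ?_⟩
        simp only [map_mul, map_pow, vM, vT, vH]; ring
      · refine ⟨1, 0, 0, _, by simpa using mMT, ?_⟩
        simp only [map_mul, vM, vT]; ring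
      · refine ⟨2, 0, 0, _, mM2TH, ?_⟩
        simp only [map_mul, map_pow, vM, vT, vH]; ring
      · refine ⟨2, 0, 0, _, mM2TH, ?_⟩
        simp only [map_mul, map_pow, vM, vT, vH]; ring
      -- (c,c,c): ξ³ ← M³T′
      · refine ⟨2, 0, 0, _, mM3T, ?_⟩
        simp only [map_mul, map_pow, vM, vT]; ring
    · -- weight-2 triples: `i, j, l ∈ {a, d}`
      rw [ThirdCone.coe_vertexGen, ThirdCone.vertexExp, monomial_triple, ← hQ]
      rcases (cubicWeight_eq_two_iff n a b c d had hbd hcd i).mp hi with hi' | hi' <;>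
        rcases (cubicWeight_eq_two_iff n a b c d had hbd hcd j).mp hj with hj' | hj' <;>
          rcases (cubicWeight_eq_two_iff n a b c d had hbd hcd l).mp hl with hl' | hl' <;>
            (obtain rfl := hi'.symm; obtain rfl := hj'.symm; obtain rfl := hl'.symm; dsimp only)
      -- (a,a,a): A³ ← x_a³, e′ = 2
      · refine ⟨1, 0, 2, _, by simpa using mA3, ?_⟩
        simp only [map_pow, vA]; ring
      -- two `a`, one `d`: A²η₁ ← x_a²Δ₇T′ (μ = 3, e′ = 2); one `a`, two `d`: Aη₁² ← x_aΔ₇²H′ (μ = 4, e′ = 1)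
      · refine ⟨3, 0, 2, _, mA2DT, ?_⟩
        simp only [map_mul, map_pow, vA, vD, vT]; ring
      · refine ⟨3, 0, 2, _, mA2DT, ?_⟩
        simp only [map_mul, map_pow, vA, vD, vT]; ring
      · refine ⟨4, 0, 1, _, mAD2H, ?_⟩
        simp only [map_mul, map_pow, vA, vD, vH]; ring
      · refine ⟨3, 0, 2, _, mA2DT, ?_⟩
        simp only [map_mul, map_pow, vA, vD, vT]; ring
      · refine ⟨4, 0, 1, _, mAD2H, ?_⟩
        simp only [map_mul, map_pow, vA, vD, vH]; ring
      · refine ⟨4, 0, 1, _, mAD2H, ?_⟩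
        simp only [map_mul, map_pow, vA, vD, vH]; ring
      -- (d,d,d): η₁³ ← Δ₇³T′H′, μ = 6, e′ = 1
      · refine ⟨6, 0, 1, _, mD3TH, ?_⟩
        simp only [map_mul, map_pow, vD, vT, vH]; ring
    · -- mixed pairs: `i ∈ {b, c}`, `j ∈ {a, d}`
      rw [ThirdCone.coe_vertexGen, ThirdCone.vertexExp, monomial_pair, ← hQ]
      rcases (cubicWeight_eq_one_iff n a b c d hab hac hbc i).mp hi with hi' | hi' <;>
        rcases (cubicWeight_eq_two_iff n a b c d had hbd hcd j).mp hj with hj' | hj' <;>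
          (obtain rfl := hi'.symm; obtain rfl := hj'.symm; dsimp only)
      -- (b,a): lA ← x_aT′, e′ = 1
      · refine ⟨1, 0, 1, _, by simpa using mAT, ?_⟩
        simp only [map_mul, vA, vT]; ring
      -- (b,d): lη₁ ← Δ₇H′, μ = 2
      · refine ⟨2, 0, 0, _, mDH, ?_⟩
        simp only [map_mul, vD, vH]; ring
      -- (c,a): ξA ← x_aMT′H′, μ = 2, e′ = 1
      · refine ⟨2, 0, 1, _, mAMTH, ?_⟩
        simp only [map_mul, vA, vM, vT, vH]; ring
      -- (c,d): ξη₁ ← MΔ₇, μ = 2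
      · refine ⟨2, 0, 0, _, mMD, ?_⟩
        simp only [map_mul, vM, vD]; ring
  · -- weight-0 variables: `η₂ = X e` and the passengers
    dsimp only
    obtain ⟨hia, hib, hic, hid⟩ := (cubicWeight_eq_zero_iff n a b c d i).mp hi
    by_cases hie : i = e
    · subst hie
      -- η₂ ← U₈/24, μ = 2
      refine ⟨2, 0, 0, _, mU, ?_⟩
      rw [← hQ, map_mul, twistedChart_C, vU]
      linear_combination (X i * (X b ^ 6 * JordanFour.twistedQ k n a b d) ^ 4) * h24
    · refine ⟨0, 0, 0, X i, by simp, ?_⟩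
      rw [twistedChart_X_of_ne k n a b c d e i hia hib hic hid hie]
      ring

include hab hac had hae hbc hbd hbe hcd hce hde in
-- instance bookkeeping of the homogeneous localisation is individually cheap but long
set_option maxHeartbeats 800000 in
/-- **The T2-analogue `eE` (RUNG V5 brick B3, ring level).** For every localisation `C` of the Rees
chart ring `B₁ = (k[x][I₁₂t])_{(H′²t)}` at `θ₁ = (T′²H′t²)/(H′²t)²` there is a ring isomorphism
`eE : C ≃+* E₁ = k[S][1/Q] ⊆ k[x][1/Q]` (`S` = the cubic vertex monomials ∪ `{η₂}` ∪ passengers,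
`k[S] = ThirdCone.cone k n (cubicWeight n a b c d)`), with `eE (F/1) = ψ₅ F`,
`eE ((g_jt)/(H′²t)) = q_j · Q⁻²` and `eE θ₁ = Q⁻¹` (`char k ≥ 5`). [OURS · L1 W4.5c] -/
theorem exists_chartW₁_away_ringEquiv (h2 : (2 : k) ≠ 0) (h3 : (3 : k) ≠ 0)
    (C : Type) [CommRing C] [Algebra B₁ C] [IsLocalization.Away θ₁ C] :
    ∃ eE : C ≃+* ↥E₁,
      (∀ F : MvPolynomial (Fin n) k,
        ((eE ((algebraMap B₁ C : B₁ →+* C) (φ₁ F)) : _) : LQ) =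
          algebraMap (MvPolynomial (Fin n) k) LQ (twistedChart k n a b c d e F)) ∧
      (∀ j : Fin 40,
        ((eE ((algebraMap B₁ C : B₁ →+* C) (HomogeneousLocalization.Away.mk (reesGrading (I12 k n a b c d))
          (reesT_mem (JordanFour.hPrime k n a b c ^ 2) (hPrime_sq_mem_I12 k n a b c d)) 1
          (reesT (gens12 k n a b c d j) (Ideal.mem_span_range_self (f := gens12 k n a b c d) (x := j)))
          (reesT_mem_one_smul (gens12 k n a b c d) j))) : _) : LQ) =
          algebraMap (MvPolynomial (Fin n) k) LQ (twistedCofactor12 k n a b c d j) *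
            IsLocalization.Away.invSelf Qp ^ 2) ∧
      ((eE ((algebraMap B₁ C : B₁ →+* C) (θ₁ : B₁)) : _) : LQ) = IsLocalization.Away.invSelf Qp := by
  have hQ := twistedQ_eq_literal k n a b d
  have hψT : twistedChart k n a b c d e (JordanFour.hPrime k n a b c ^ 2) = X b ^ 12 * Qp ^ 2 := by
    rw [map_pow, twistedChart_hPrime k n a b c d e hab hac hbc h2, hQ]; ring
  have hψH3 : twistedChart k n a b c d e (JordanFour.tPrime k n a b c d ^ 2 * JordanFour.hPrime k n a b c) *
      Qp = (X b ^ 12 * Qp ^ 2) ^ 2 := by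
    rw [map_mul, map_pow, twistedChart_hPrime k n a b c d e hab hac hbc h2,
      twistedChart_tPrime k n a b c d e hab hac had hbc hbd hcd h2 h3, hQ]; ring
  have hcone := adjoin_vertexGen_eq_cone k n (cubicWeight n a b c d)
  have hqE : ∀ j, twistedCofactor12 k n a b c d j ∈ Algebra.adjoin k Sset := by
    intro j; rw [hcone]; exact twistedCofactor12_mem_cone k n a b c d hab hac had hbc hbd hcd j
  have hψE : ∀ i, twistedChart k n a b c d e (X i) ∈ Algebra.adjoin k Sset := by
    intro i; rw [hcone]
    exact twistedChart_mem_cone k n a b c d e hab hac had hae hbc hbd hbe hcd hce hde (X i)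
  have hQE : Qp ∈ Algebra.adjoin k Sset := by
    rw [hcone, ← hQ]; exact twistedQ_mem_cone k n a b c d hab had hbd hcd
  exact @exists_ringEquiv_of_twistData_inv k _ n a b d 40 (gens12 k n a b c d)
    (JordanFour.hPrime k n a b c ^ 2) (hPrime_sq_mem_I12 k n a b c d)
    (JordanFour.tPrime k n a b c d ^ 2 * JordanFour.hPrime k n a b c) (tPrime_sq_mul_hPrime_mem_I12_sq k n a b c d)
    12 2 (twistedChart k n a b c d e) (twistedChart_injective k n a b c d e hab hac had hae hbc hbd hbe hcd hce hde h2 h3)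
    hψT hψH3 (twistedCofactor12 k n a b c d) (twistedChart_gens12 k n a b c d e hab hac had hbc hbd hcd)
    Sset hqE hψE hQE (twistedChart_dictionary k n a b c d e hab hac had hae hbc hbd hbe hcd hce hde h2 h3) C _
    ‹_› ‹_›

end Model

end Summit.ResolutionOfSingularities.ResolutionOfSingularities.Theorems.WildQuotientResolution.JordanFive

end
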